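import Summits.QuantumFields.BalabanUV.T4Continuum.Support.NE7LawLevelSocket

/-!
# NE7, ROAD P4 (law-level / second-moment lineage), FILE 2 of 2: NODE Q (conditional dressing means) and THE END
# (leaves P/S/D/W/Q ⊢ the law-level NE7 for the ℝ-laws and `Missing.HasContinuumLimit`)

(Cell `pub-balaban`, sub-cell `t4`, binder row NE7 = node U5, co-owner #4 `b2b-balaban-t4-ne7-p4`, ROUND-2 skeleton;
companion record `HOME/t4/skeletons/NE7-t4-ne7-p4.md`; file 1 = `NE7LawLevelSocket`.)

HONEST FRAMING (T4-DAG PAGE 1).  Rung (B)+1 on ONE FIXED finite four-torus, CONDITIONAL on `BetaPertH` and the nine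
spine estimates (0/9 proved); NOT infinite volume, NOT a mass gap, NOT the Clay problem.  NE7 is NOT PRINTED and NOT
proved here; every `def … : Prop` is a HYPOTHESIS SHAPE, every theorem [folklore] and sorry-free; no statement of the
audited series is asserted; `BetaPertH`, (B), (B^μ) enter no declaration.  NOT summit progress.

THE POINT OF THIS FILE.  Bałaban's densities are `(ℝT)^K ρ₀` — laws `ν K` of the endpoint of the averaging-and-
resampling chain ([Balaban1989LargeFieldI] (0.3)/(0.4) p. 176, quoted verbatim in `T4PathwiseCoupling`'s header) — and
equal the true push-forward `(avg^K)_* μ` only in TOTAL mass ((1.102) p. 201, quoted in T4-DAG §0 H2).  True joint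
expectations are read through CONDITIONAL DRESSING MEANS `m K os` (`⟨∏_{os} W⟩_K = ∫ m K os dν_K`, `|m| ≤ 1`; the object
«E[dressing ∣ endpoint]» of row NE1′'s coupling lane `T4PathwiseCoupling`), and the increment splits EXACTLY:
  `⟨W⟩_{K+1} − ⟨W⟩_K = ∫ (m_{K+1} − m_K) dν_{K+1} + (∫ m_K dν_{K+1} − ∫ m_K dν_K)`,
second bracket `≤ 2·TV(ν_{K+1}, ν_K)` (maximal coupling, `T4MaximalCoupling`), first bracket = NODE Q.  On this road
NO source dressing, NO dressed stability (B^μ), NO t-uniformity and NO cross-run relative weight occur; the price is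
NODE Q — a two-run rate for the dressing means, cut in §5b into an OLD part (single-run, each run under its own law)
and a RECENT part (two-run), shared with row NE1′.

WHAT IS PROVED HERE:
§5  `abs_integral_sub_integral_le_of_tvSeq` (TV step for `|g| ≤ 1`); shapes `DressingMeans S ν m`,
    `DressingMeanRate ν m q`; `abs_expectAt_succ_sub_le` (the exact split); `hasContinuumLimit_of_dressingMeans`
    (summable TV + summable dressing-mean rate ⇒ `HasContinuumLimit S`, via
    `T4VarianceMatching.hasContinuumLimit_of_summable_increments`: no generating function, no Vitali).
§5b shapes `OldResamplingSmall` (single-run), `RecentResamplingRate` (two-run); `dressingMeanRate_of_split`.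
§6  `termMeanHybridSeq_of_leaves` (leaves P/S/D/W ⊢ the term socket, W through `T4WeightBudget.RelWeightBound` at
    source zero), `tvSeq_summable_of_leaves` (the law-level NE7 for the ℝ-laws: summable TV rate),
    `hasContinuumLimit_of_leaves` (+ NODE Q ⊢ the apex).
-/

noncomputable section

open MeasureTheory

namespace Summit.QuantumFields.BalabanUV.T4Continuum.NE7LawLevel

open Literature.MathematicalPhysics.QuantumFieldTheory.Balaban1983to89
open T4PathMeanHybrid T4MaximalCoupling T4HybridMatching T4VarianceMatching Missing

/-! ## §5 NODE Q and the apex: dressing means, the exact increment split, and `HasContinuumLimit` -/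

section Dressing

variable {X : Type*} [MeasurableSpace X]

/-- **TV step for bounded integrands**: under `TVSeq ν t`, every measurable `|g| ≤ 1` has
`|∫ g dν_{K+1} − ∫ g dν_K| ≤ 2 t_K` (through the maximal coupling of `T4MaximalCoupling`). [folklore] -/
theorem abs_integral_sub_integral_le_of_tvSeq {ν : ℕ → Measure X} [hν : ∀ K, IsProbabilityMeasure (ν K)]
    {t : ℕ → ℝ} (h : TVSeq ν t) {g : X → ℝ} (hg : Measurable g) (hb : ∀ u, |g u| ≤ 1) (K : ℕ) :
    |∫ u, g u ∂(ν (K + 1)) - ∫ u, g u ∂(ν K)| ≤ 2 * t K := by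
  obtain ⟨ht0, hA⟩ := h K
  haveI := hν K
  haveI := hν (K + 1)
  have hmass := univ_eq_univ_of_prob (ν K) (ν (K + 1))
  set π := maxCoupling (ν K) (ν (K + 1)) with hπ
  haveI : IsProbabilityMeasure π := isProbabilityMeasure_maxCoupling _ _
  have h1 : π.map Prod.fst = ν K := map_fst_maxCoupling _ _ hmass
  have h2 : π.map Prod.snd = ν (K + 1) := map_snd_maxCoupling _ _ hmass
  have e1 : ∫ u, g u ∂(ν K) = ∫ p, g p.1 ∂π := by
    rw [← integral_map measurable_fst.aemeasurable hg.aestronglyMeasurable, h1]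
  have e2 : ∫ u, g u ∂(ν (K + 1)) = ∫ p, g p.2 ∂π := by
    rw [← integral_map measurable_snd.aemeasurable hg.aestronglyMeasurable, h2]
  have hI1 : Integrable (fun p : X × X => g p.1) π :=
    integrable_of_abs_le π (hg.comp measurable_fst) (B := 1) fun p => hb p.1
  have hI2 : Integrable (fun p : X × X => g p.2) π :=
    integrable_of_abs_le π (hg.comp measurable_snd) (B := 1) fun p => hb p.2
  rw [e1, e2, ← integral_sub hI2 hI1]
  have hd : (deficit (ν K) (ν (K + 1))).toReal ≤ t K :=
    (ENNReal.toReal_mono ENNReal.ofReal_ne_top (deficit_le_of_forall_le _ _ hA)).trans_eq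
      (ENNReal.toReal_ofReal ht0)
  calc |∫ p, (g p.2 - g p.1) ∂π| ≤ ∫ p, |g p.2 - g p.1| ∂π := abs_integral_le_integral_abs
    _ ≤ 2 * 1 * (deficit (ν K) (ν (K + 1))).toReal :=
        integral_abs_sub_le_maxCoupling _ _ hmass hg zero_le_one hb
    _ ≤ 2 * t K := by rw [mul_one]; exact mul_le_mul_of_nonneg_left hd zero_le_two

variable {G : Type*} {O : Type*} [MeasurableSpace G] [GaugeGroup G] [HaarData G] (S : TorusScheme G O)

/-- **NODE Q, representation half (hypothesis shape): CONDITIONAL DRESSING MEANS.**  For every `K` and every string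
`os`, a measurable `m K os : X → [−1, 1]` with `⟨∏_{o∈os} obs_K(o)⟩ = ∫ m K os dν_K`.  For Bałaban's scheme: `ν K` =
the normalised `(ℝT)^K ρ₀ dV` (law of the endpoint `V_K` of the averaging-and-resampling chain) and
`m K os = E[∏ W_o(avg^K U₀) ∣ V_K]` — the conditional dressing mean of row NE1′'s coupling lane («the dressed final
density as (undressed) × E[dressing ∣ endpoint]», `T4PathwiseCoupling`); it EXISTS by disintegration once the chain is
constructed (mass preservation of `ℝ`, [Balaban1989LargeFieldI] (0.4) p. 176).  When `ν K` is the TRUE push-forward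
law, `m K os = ∏ W_o` (K-independent) and NODE Q is void. [folklore] -/
def DressingMeans (ν : ℕ → Measure X) (m : ℕ → List O → X → ℝ) : Prop :=
  ∀ K os, Measurable (m K os) ∧ (∀ u, |m K os u| ≤ 1) ∧ S.expectAt K os = ∫ u, m K os u ∂(ν K)

/-- **NODE Q, estimate half (hypothesis shape, NOT PRINTED, OWN-OPEN shared with row NE1′): the DRESSING-MEAN RATE.**
Consecutive runs' conditional dressing means differ, in the mean under the later run's law, by `≤ C_{os} · q_K`.
[folklore] -/
def DressingMeanRate (ν : ℕ → Measure X) (m : ℕ → List O → X → ℝ) (q : ℕ → ℝ) : Prop :=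
  ∀ os, ∃ C : ℝ, ∀ K, ∫ u, |m (K + 1) os u - m K os u| ∂(ν (K + 1)) ≤ C * q K

omit [MeasurableSpace G] [GaugeGroup G] [HaarData G] in
/-- **THE EXACT INCREMENT SPLIT and its bound**: with dressing means and a TV rate,
`|⟨W⟩_{K+1} − ⟨W⟩_K| ≤ ∫ |m_{K+1} − m_K| dν_{K+1} + 2 t_K`. [folklore] -/
theorem abs_expectAt_succ_sub_le [MeasurableSpace G] [GaugeGroup G] [HaarData G] (S : TorusScheme G O)
    {ν : ℕ → Measure X} [∀ K, IsProbabilityMeasure (ν K)]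
    {m : ℕ → List O → X → ℝ} (hm : DressingMeans S ν m) {t : ℕ → ℝ} (ht : TVSeq ν t) (K : ℕ) (os : List O) :
    |S.expectAt (K + 1) os - S.expectAt K os| ≤
      ∫ u, |m (K + 1) os u - m K os u| ∂(ν (K + 1)) + 2 * t K := by
  obtain ⟨hm1, hb1, he1⟩ := hm (K + 1) os
  obtain ⟨hm0, hb0, he0⟩ := hm K os
  have hi1 : Integrable (m (K + 1) os) (ν (K + 1)) := integrable_of_abs_le _ hm1 (B := 1) hb1
  have hi0 : Integrable (m K os) (ν (K + 1)) := integrable_of_abs_le _ hm0 (B := 1) hb0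
  rw [he1, he0]
  have hsplit : ∫ u, m (K + 1) os u ∂(ν (K + 1)) - ∫ u, m K os u ∂(ν K) =
      (∫ u, (m (K + 1) os u - m K os u) ∂(ν (K + 1))) +
        (∫ u, m K os u ∂(ν (K + 1)) - ∫ u, m K os u ∂(ν K)) := by
    rw [integral_sub hi1 hi0]; ring
  rw [hsplit]
  refine (abs_add_le _ _).trans (add_le_add ?_ ?_)
  · exact abs_integral_le_integral_abs
  · exact abs_integral_sub_integral_le_of_tvSeq ht hm0 hb0 K

omit [MeasurableSpace G] [GaugeGroup G] [HaarData G] in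
/-- **NODE K, apex half: dressing means + dressing-mean rate + TV rate, all summable ⇒ `HasContinuumLimit S`**
(through `T4VarianceMatching.hasContinuumLimit_of_summable_increments`: no generating function, no Vitali, no
countability of the observable family). [folklore] -/
theorem hasContinuumLimit_of_dressingMeans [MeasurableSpace G] [GaugeGroup G] [HaarData G] (S : TorusScheme G O)
    {ν : ℕ → Measure X} [∀ K, IsProbabilityMeasure (ν K)] {m : ℕ → List O → X → ℝ} (hm : DressingMeans S ν m)
    {q t : ℕ → ℝ} (hq : DressingMeanRate ν m q) (ht : TVSeq ν t) (hqs : Summable q) (hts : Summable t) :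
    HasContinuumLimit S := by
  refine T4VarianceMatching.hasContinuumLimit_of_summable_increments S fun os => ?_
  obtain ⟨C, hC⟩ := hq os
  refine ⟨fun K => C * q K + 2 * t K, (hqs.mul_left C).add (hts.mul_left 2), fun K => ?_⟩
  exact (abs_expectAt_succ_sub_le S hm ht K os).trans (add_le_add (hC K) le_rfl)

/-! ### §5b NODE Q's internal cut: old resamplings single-run, recent resamplings two-run -/

/-- **LEAF Q.old (single-run, hypothesis shape): the OLD resamplings are invisible in the mean.**  The part `dold K os`
of the dressing correction `m K os − ∏W` produced by resamplings OLDER than the road's window (creation level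
`< jlog K`) has mean absolute size `≤ C_{os}·s_K` under the run's OWN law — for Bałaban's scheme: averaging dilution of an
old component's footprint in the unit-scale block average (`L^{-3(K−k)}`-type) against its count, booked in ℓ¹ ONLY
on the window's complement where dilution wins (the ℓ²/Azuma booking of row NE1′-P2 is the all-ages device; here ages
`≥ K − jlog K` suffice).  NOT PRINTED. [folklore] -/
def OldResamplingSmall (ν : ℕ → Measure X) (dold : ℕ → List O → X → ℝ) (s : ℕ → ℝ) : Prop :=
  ∀ os, ∃ C : ℝ, 0 ≤ C ∧ ∀ K, Measurable (dold K os) ∧ (∀ u, |dold K os u| ≤ 2) ∧ 0 ≤ s K ∧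
    ∫ u, |dold K os u| ∂(ν K) ≤ C * s K

/-- **LEAF Q.rec (two-run, hypothesis shape, OWN-OPEN shared with row NE1′): the RECENT resamplings of consecutive runs
match in the mean** — the part `drec K os` of the dressing correction produced by resamplings of ages `≤ K − jlog K`
(their ingredients are the two runs' recent-scale small-field Gibbs factors of [Balaban1989LargeFieldII] (1.1): same
rates as NODE S's recent kinds, rows NE2/NE3/NE5, propagated through the common positive resampling operation).
NOT PRINTED. [folklore] -/
def RecentResamplingRate (ν : ℕ → Measure X) (drec : ℕ → List O → X → ℝ) (ϱ : ℕ → ℝ) : Prop :=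
  ∀ os, ∃ C : ℝ, 0 ≤ C ∧ ∀ K, Measurable (drec K os) ∧ Measurable (drec (K + 1) os) ∧
    (∀ u, |drec (K + 1) os u - drec K os u| ≤ 4) ∧ 0 ≤ ϱ K ∧
    ∫ u, |drec (K + 1) os u - drec K os u| ∂(ν (K + 1)) ≤ C * ϱ K

/-- **NODE Q = Q.old ⊕ Q.rec ⊕ the TV rate.**  If the dressing means split as `m K os = w os + dold K os + drec K os`
with a K-INDEPENDENT undressed part `w os` (the product of unit-lattice loop variables itself), then
`∫ |m_{K+1} − m_K| dν_{K+1} ≤ C·(s_{K+1} + s_K + t_K + ϱ_K)`: the old parts are charged to each run's OWN law (run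
`K`'s through one TV step, `|dold| ≤ 2`), the recent parts to the two-run rate. [folklore] -/
theorem dressingMeanRate_of_split {ν : ℕ → Measure X} [hν : ∀ K, IsProbabilityMeasure (ν K)]
    {m : ℕ → List O → X → ℝ} {w : List O → X → ℝ} {dold drec : ℕ → List O → X → ℝ} {s ϱ t : ℕ → ℝ}
    (hsplit : ∀ K os u, m K os u = w os u + dold K os u + drec K os u)
    (hold : OldResamplingSmall ν dold s) (hrec : RecentResamplingRate ν drec ϱ) (ht : TVSeq ν t) :
    DressingMeanRate ν m fun K => s (K + 1) + s K + t K + ϱ K := by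
  intro os
  obtain ⟨C₁, hC₁0, hC₁⟩ := hold os
  obtain ⟨C₂, hC₂0, hC₂⟩ := hrec os
  refine ⟨max (max C₁ 4) C₂, fun K => ?_⟩
  obtain ⟨hmo1, hbo1, hs1, hio1⟩ := hC₁ (K + 1)
  obtain ⟨hmo0, hbo0, hs0, hio0⟩ := hC₁ K
  obtain ⟨hmr0, hmr1, hbr, hϱ0, hir⟩ := hC₂ K
  obtain ⟨ht0, -⟩ := ht K
  haveI := hν K
  haveI := hν (K + 1)
  set M := max (max C₁ 4) C₂ with hM
  have hM1 : C₁ ≤ M := (le_max_left _ _).trans (le_max_left _ _)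
  have hM4 : (4 : ℝ) ≤ M := (le_max_right _ _).trans (le_max_left _ _)
  have hM2 : C₂ ≤ M := le_max_right _ _
  -- pointwise: |m_{K+1} − m_K| ≤ |dold_{K+1}| + |dold_K| + |drec_{K+1} − drec_K|
  have hpt : ∀ u, |m (K + 1) os u - m K os u| ≤
      |dold (K + 1) os u| + |dold K os u| + |drec (K + 1) os u - drec K os u| := fun u => by
    rw [hsplit (K + 1) os u, hsplit K os u]
    have e : w os u + dold (K + 1) os u + drec (K + 1) os u - (w os u + dold K os u + drec K os u) =
        dold (K + 1) os u + (-dold K os u) + (drec (K + 1) os u - drec K os u) := by ring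
    rw [e]
    refine (abs_add_le _ _).trans (add_le_add ((abs_add_le _ _).trans (add_le_add le_rfl ?_)) le_rfl)
    rw [abs_neg]
  have hi1 : Integrable (fun u => |dold (K + 1) os u|) (ν (K + 1)) :=
    integrable_of_abs_le _ (continuous_abs.measurable.comp hmo1) (B := 2) fun u => by rw [abs_abs]; exact hbo1 u
  have hi0 : Integrable (fun u => |dold K os u|) (ν (K + 1)) :=
    integrable_of_abs_le _ (continuous_abs.measurable.comp hmo0) (B := 2) fun u => by rw [abs_abs]; exact hbo0 u
  have hir' : Integrable (fun u => |drec (K + 1) os u - drec K os u|) (ν (K + 1)) :=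
    integrable_of_abs_le _ (continuous_abs.measurable.comp (hmr1.sub hmr0)) (B := 4) fun u => by
      rw [abs_abs]; exact hbr u
  -- the TV transfer of run K's old part: ∫ |dold_K| dν_{K+1} ≤ ∫ |dold_K| dν_K + 4 t_K
  have htv : ∫ u, |dold K os u| ∂(ν (K + 1)) ≤ ∫ u, |dold K os u| ∂(ν K) + 4 * t K := by
    have h := abs_integral_sub_integral_le_of_tvSeq ht (g := fun u => |dold K os u| / 2)
      ((continuous_abs.measurable.comp hmo0).div_const 2) (fun u => by
        rw [abs_div, abs_abs, abs_two]; linarith [hbo0 u]) K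
    rw [integral_div, integral_div, ← sub_div, abs_div, abs_two, div_le_iff₀ (two_pos : (0 : ℝ) < 2)] at h
    have h' := (abs_le.mp h).2
    linarith
  calc ∫ u, |m (K + 1) os u - m K os u| ∂(ν (K + 1))
      ≤ ∫ u, (|dold (K + 1) os u| + |dold K os u| + |drec (K + 1) os u - drec K os u|) ∂(ν (K + 1)) :=
        integral_mono_of_nonneg (ae_of_all _ fun u => abs_nonneg _) ((hi1.add hi0).add hir') (ae_of_all _ hpt)
    _ = ∫ u, |dold (K + 1) os u| ∂(ν (K + 1)) + ∫ u, |dold K os u| ∂(ν (K + 1)) +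
          ∫ u, |drec (K + 1) os u - drec K os u| ∂(ν (K + 1)) := by
        have hA : Integrable (fun u => |dold (K + 1) os u| + |dold K os u|) (ν (K + 1)) := hi1.add hi0
        rw [integral_add hA hir', integral_add hi1 hi0]
    _ ≤ C₁ * s (K + 1) + (C₁ * s K + 4 * t K) + C₂ * ϱ K :=
        add_le_add (add_le_add hio1 (htv.trans (add_le_add hio0 le_rfl))) hir
    _ ≤ M * s (K + 1) + (M * s K + M * t K) + M * ϱ K :=
        add_le_add (add_le_add (mul_le_mul_of_nonneg_right hM1 hs1)
          (add_le_add (mul_le_mul_of_nonneg_right hM1 hs0) (mul_le_mul_of_nonneg_right hM4 ht0)))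
          (mul_le_mul_of_nonneg_right hM2 hϱ0)
    _ = M * (s (K + 1) + s K + t K + ϱ K) := by ring

end Dressing

/-! ## §6 THE END: the leaves P, S, D, W, Q of the road ⊢ the law-level NE7 for the ℝ-laws and the apex -/

section End

variable {X : Type*} [MeasurableSpace X]

/-- **THE LEAVES ⇒ THE TERM-WISE SOCKET.**  Per `K`, on the synchronised label set `T K` with bad class `Bad K 0`
(node U5a / I-3 at source zero):
* (P) FORMAT/POSITIVITY: measurable nonnegative term densities `a K τ`, `b K τ` with everywhere-positive totals; the
  run-`K` law IS the normalised density law of `Σ a`, the run-`K+1` law that of `Σ b`, and the latter is the Gibbs tilt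
  of the former by the log-ratio of totals (tilt hygiene; for the normalised laws of two positive densities this is
  definitional, asked here as a clause exactly as in `T4PathMeanHybrid.EffTermMeanHybrid`);
* (S) the GOOD-CLASS TERM SANDWICH at source zero, pointwise on the cores, with a field-independent constant `c K` and
  radius `totalRadius kinds ρ K` (produced kind by kind through `termSandwich_of_factorSandwich`);
* (D) single-run CORE-COMPLEMENT masses `≤ sA K`, `≤ sB K`;
* (W) node U5c's `RelWeightBound l₀ T A B Bad W` with the identification of the source-zero term weights with the
  integrated densities;
then `TermMeanHybridSeq ν (totalRadius kinds ρ) (W + sA) (W + sB)`. [folklore] -/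
theorem termMeanHybridSeq_of_leaves {κ : Type*} (kinds : Finset κ) (ρ : κ → ℕ → ℝ)
    (hρ0 : ∀ i ∈ kinds, ∀ K, 0 ≤ ρ i K) (vol : Measure X) (ν : ℕ → Measure X)
    (T : ℕ → Finset ℕ) (Bad : ℕ → ℝ → Finset ℕ) (a b : ℕ → ℕ → X → ℝ) (c : ℕ → ℝ) (Sa Sb : ℕ → Set X)
    {l₀ : ℝ} (hl₀ : 0 ≤ l₀) {A B : ℕ → ℝ → ℕ → ℝ} {W sA sB : ℕ → ℝ}
    -- (P) format / positivity / tilt hygiene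
    (ham : ∀ K, ∀ τ ∈ T K, Measurable (a K τ)) (hbm : ∀ K, ∀ τ ∈ T K, Measurable (b K τ))
    (ha0 : ∀ K u, ∀ τ ∈ T K, 0 ≤ a K τ u) (hb0 : ∀ K u, ∀ τ ∈ T K, 0 ≤ b K τ u)
    (hapos : ∀ K u, 0 < ∑ τ ∈ T K, a K τ u) (hbpos : ∀ K u, 0 < ∑ τ ∈ T K, b K τ u)
    (hai : ∀ K, ∀ τ ∈ T K, Integrable (a K τ) vol) (hbi : ∀ K, ∀ τ ∈ T K, Integrable (b K τ) vol)
    (hZa : ∀ K, 0 < ∑ τ ∈ T K, ∫ x, a K τ x ∂vol) (hZb : ∀ K, 0 < ∑ τ ∈ T K, ∫ x, b K τ x ∂vol)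
    (hνA : ∀ K, ν K = normLawOf vol fun x => ∑ τ ∈ T K, a K τ x)
    (hνB : ∀ K, ν (K + 1) = normLawOf vol fun x => ∑ τ ∈ T K, b K τ x)
    (htilt : ∀ K, ν (K + 1) =
      (ν K).tilted (fun u => Real.log (∑ τ ∈ T K, b K τ u) - Real.log (∑ τ ∈ T K, a K τ u)))
    -- (S) good-class term sandwich at t = 0 on the cores
    (hSa : ∀ K, MeasurableSet (Sa K)) (hSb : ∀ K, MeasurableSet (Sb K))
    (hlow : ∀ K, ∀ u ∈ Sa K, ∀ τ ∈ T K \ Bad K 0,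
      Real.exp (c K - totalRadius kinds ρ K) * a K τ u ≤ b K τ u)
    (hup : ∀ K, ∀ u ∈ Sb K, ∀ τ ∈ T K \ Bad K 0,
      b K τ u ≤ Real.exp (c K + totalRadius kinds ρ K) * a K τ u)
    -- (D) core complements, single-run
    (hcA : ∀ K, (ν K).real (Sa K)ᶜ ≤ sA K) (hcB : ∀ K, (ν (K + 1)).real (Sb K)ᶜ ≤ sB K)
    -- (W) global bad weights at source zero = node U5c's output + identification
    (hRW : T4WeightBudget.RelWeightBound l₀ T A B Bad W)
    (hAK : ∀ K, ∀ τ ∈ T K, A K 0 τ = ∫ x, a K τ x ∂vol) (hBK : ∀ K, ∀ τ ∈ T K, B K 0 τ = ∫ x, b K τ x ∂vol) :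
    TermMeanHybridSeq ν (totalRadius kinds ρ) (fun K => W K + sA K) (fun K => W K + sB K) := by
  classical
  intro K
  have hl : |(0 : ℝ)| ≤ l₀ := by rw [abs_zero]; exact hl₀
  have hBadT : Bad K 0 ⊆ T K := hRW.bad_subset K 0 hl
  have hsd : T K \ (T K \ Bad K 0) = Bad K 0 := Finset.sdiff_sdiff_eq_self hBadT
  refine ⟨T K, T K \ Bad K 0, a K, b K, c K, Sa K, Sb K, Finset.sdiff_subset, ham K, hbm K, hSa K, hSb K,
    totalRadius_nonneg hρ0 K, ha0 K, hb0 K, hapos K, hbpos K, hlow K, hup K, htilt K, ?_, ?_⟩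
  · rw [hsd]
    have hw := meanBadFraction_le_left hl₀ hRW K vol (ham K) (hapos K) (hai K) (hZa K) (hAK K)
    rw [← hνA K] at hw
    exact add_le_add hw (hcA K)
  · rw [hsd]
    have hw := meanBadFraction_le_right hl₀ hRW K vol (hbm K) (hbpos K) (hbi K) (hZb K) (hBK K)
    rw [← hνB K] at hw
    exact add_le_add hw (hcB K)

/-- **THE END, law half: the leaves ⊢ the law-level NE7 for the ℝ-laws** — a TV rate
`2·totalRadius + (W + sA) + (W + sB)` which is SUMMABLE when every kind radius, the global weight and the two
core-complement masses are. [folklore] -/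
theorem tvSeq_summable_of_leaves {κ : Type*} {kinds : Finset κ} {ρ : κ → ℕ → ℝ} {ν : ℕ → Measure X}
    [∀ K, IsProbabilityMeasure (ν K)] {W sA sB : ℕ → ℝ}
    (h : TermMeanHybridSeq ν (totalRadius kinds ρ) (fun K => W K + sA K) (fun K => W K + sB K))
    (hρ : ∀ i ∈ kinds, Summable (ρ i)) (hW : Summable W) (hsA : Summable sA) (hsB : Summable sB) :
    TVSeq ν (meanHybridRate (totalRadius kinds ρ) (fun K => W K + sA K) (fun K => W K + sB K)) ∧
      Summable (meanHybridRate (totalRadius kinds ρ) (fun K => W K + sA K) (fun K => W K + sB K)) :=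
  ⟨tvSeq_of_termMeanHybridSeq h,
    summable_meanHybridRate (summable_totalRadius hρ) (hW.add hsA) (hW.add hsB)⟩

variable {G : Type*} {O : Type*} [MeasurableSpace G] [GaugeGroup G] [HaarData G]

/-- **THE END: the road's leaves ⊢ the apex `HasContinuumLimit S`.**  The term-wise socket for the ℝ-laws (from leaves
P/S/D/W by `termMeanHybridSeq_of_leaves`) with summable kind radii, global weight and core-complement masses, plus NODE
Q (dressing means with a summable rate) give the continuum limit of every joint expectation of the scheme.  CONDITIONAL
kernel theorem: none of the hypotheses is asserted for Bałaban's data. [folklore] -/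
theorem hasContinuumLimit_of_leaves (S : TorusScheme G O) {κ : Type*} {kinds : Finset κ} {ρ : κ → ℕ → ℝ}
    {ν : ℕ → Measure X} [∀ K, IsProbabilityMeasure (ν K)] {W sA sB q : ℕ → ℝ} {m : ℕ → List O → X → ℝ}
    (h : TermMeanHybridSeq ν (totalRadius kinds ρ) (fun K => W K + sA K) (fun K => W K + sB K))
    (hρ : ∀ i ∈ kinds, Summable (ρ i)) (hW : Summable W) (hsA : Summable sA) (hsB : Summable sB)
    (hm : DressingMeans S ν m) (hq : DressingMeanRate ν m q) (hqs : Summable q) :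
    HasContinuumLimit S := by
  obtain ⟨htv, hsum⟩ := tvSeq_summable_of_leaves h hρ hW hsA hsB
  exact hasContinuumLimit_of_dressingMeans S hm hq htv hqs hsum

end End

end Summit.QuantumFields.BalabanUV.T4Continuum.NE7LawLevel

end
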